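import Summits.NavierStokesRegularity.NavierStokesRegularity.Theses.QuantisedSymmetry
import Summits.NavierStokesRegularity.NavierStokesRegularity.Theorems.QuantisedSymmetryPolyhedralDssProfileExistsCellOfProfile
import Summits.NavierStokesRegularity.NavierStokesRegularity.Theorems.QuantisedSymmetryPolyhedralDssProfileExistsStubLerayOrbitOfRepresentative
import Summits.NavierStokesRegularity.NavierStokesRegularity.Theorems.QuantisedSymmetryPolyhedralDssProfileExistsStubAncientMildOfClassicalTypeI
import Literature.Analysis.FluidPDE.AncientSimilarityVariables
import HarnessLib

/-!
# Route `QuantisedSymmetry`, crux `PolyhedralDssProfileExists` (X⁻, stmt-NavierStokesRegularity-1404), line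
# `polyhedral_cell` — registered stub `stub_lerayOrbitOfProfile` (lead c15): THE CRUX IS A PERIODIC POLYHEDRAL
# ORBIT OF THE BACKWARD LERAY SYSTEM, and `PolyhedralDssProfileExists ↔ PeriodicLerayOrbitExists`

In backward similarity variables `U(s, y) = √(−t) u(t, x)`, `y = x/√(−t)`, `s = −log(−t)` a Type-I `λ`-DSS ancient
solution is a `2 log λ`-periodic orbit of the autonomous backward Leray system
`∂ₛU + ½U + ½(y·∇)U + (U·∇)U + ∇P = ΔU`, `div U = 0`, with the profile bound `(1 + |y|)|U| ≤ C₀` (the parked line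
`birth`, whose direction orbit ⇒ X⁻ is re-proved here against the landed `Birth.stub_ancientMild_of_classical_typeI`,
p148604). This file proves the converse X⁻ ⇒ orbit by assembling `stub_smoothRepresentative_ae` (p156260),
`stub_transport_ae` (p155960) and `stub_lerayOrbitOfRepresentative` (p155979), and records the equivalence. With
`polyhedralDssProfileExists_iff_cell` the three formulations of the crux — duality-form profile, polyhedral cell,
periodic Leray orbit — are certified equivalent: the open ∃-content is reformulation-invariant.
-/

set_option linter.dupNamespace false

namespace Summit.NavierStokesRegularity.NavierStokesRegularity.Theorems.PolyhedralDssProfileExists.PolyhedralCell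

open MeasureTheory Set Function Filter Topology
open Literature.Analysis.FluidPDE

/-- **REGISTERED STUB `stub_lerayOrbitOfProfile` (line `polyhedral_cell`, lead c15): the crux yields a periodic
polyhedrally-equivariant Type-I orbit of the backward Leray system** (the body is `Birth.PeriodicLerayOrbitExists` of
the parked line). From a witness `(G, λ, u)`: Oseen-gauge representative (`stub_smoothRepresentative_ae`), transport
of DSS/equivariance (`stub_transport_ae`), a nonzero point, and the similarity dictionary
(`stub_lerayOrbitOfRepresentative`: `U = lerayOrbit V`, period `S = 2 log λ > 0`). [cite: ChaeWolf2017RemovingDSS, §4; BradshawTsai2017CPDE, §5 Open Problem 5.1] -/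
theorem stub_lerayOrbitOfProfile :
    _root_.Summit.NavierStokesRegularity.NavierStokesRegularity.Theses.QuantisedSymmetry.PolyhedralDssProfileExists →
      ∃ G : Subgroup (EuclideanSpace ℝ (Fin 3) ≃ₗᵢ[ℝ] EuclideanSpace ℝ (Fin 3)), Finite G ∧
      (∀ g ∈ G, LinearMap.det (g.toLinearEquiv : EuclideanSpace ℝ (Fin 3) →ₗ[ℝ] EuclideanSpace ℝ (Fin 3)) = 1) ∧
      (∀ V : Submodule ℝ (EuclideanSpace ℝ (Fin 3)), (∀ g ∈ G, ∀ v ∈ V, g v ∈ V) → V = ⊥ ∨ V = ⊤) ∧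
      ∃ S : ℝ, 0 < S ∧ ∃ (U : ℝ → EuclideanSpace ℝ (Fin 3) → EuclideanSpace ℝ (Fin 3))
        (P : ℝ → EuclideanSpace ℝ (Fin 3) → ℝ),
        IsBackwardLeraySolutionOn univ 1 U P ∧ Function.Periodic U S ∧
        (∃ C₀ : ℝ, ∀ s y, (1 + ‖y‖) * ‖U s y‖ ≤ C₀) ∧
        (∀ g ∈ G, ∀ s y, U s (g y) = g (U s y)) ∧ (∃ s y, U s y ≠ 0) := by
  rintro ⟨G, hfin, hdet, hirr, c, hc, u, hanc, hmeas, hdss, ⟨C₀, hdec⟩, heqv, hnt⟩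
  obtain ⟨V, C, hV, hdecV, hae, hzero⟩ := stub_smoothRepresentative_ae u C₀ hanc hmeas hdec
  obtain ⟨hdssV, heqvV⟩ := stub_transport_ae G c u V C hc hdss heqv hV hae hzero
  obtain ⟨t₀, ht₀, x₀, hx₀⟩ := exists_apply_ne_zero_of_ae_repr hae hnt
  obtain ⟨U, P, hsol, hper, hbd, heqU, hne⟩ :=
    stub_lerayOrbitOfRepresentative G c V C C₀ t₀ x₀ hc hV hdssV hdecV heqvV ht₀ hx₀
  exact ⟨G, hfin, hdet, hirr, 2 * Real.log c, mul_pos two_pos (Real.log_pos hc), U, P, hsol, hper,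
    ⟨C₀, hbd⟩, heqU, hne⟩

/-- **A periodic polyhedral Type-I orbit of the backward Leray system yields the crux** (the composition of the
parked line `birth`, against the landed `Birth.stub_ancientMild_of_classical_typeI`, p148604): the physical field
`u = ofLerayOrbit U` is classical on the past (`isClassicalNSSolutionOn_Iio_ofLerayOrbit_iff`), Type I
(`hasTypeIDecay_iff_lerayOrbit`), hence ancient mild in the duality form; it is `λ`-DSS with `λ = e^{S/2} > 1`
(`periodic_lerayOrbit_iff` on the past, both sides `0` on `t ≥ 0`), `G`-equivariant, with continuous hence
measurable slices, and not a.e. trivial (`lerayOrbit ∘ ofLerayOrbit = id`). [cite: ChaeWolf2017RemovingDSS, §4] -/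
theorem polyhedralDssProfileExists_of_periodicLerayOrbit
    (h : ∃ G : Subgroup (EuclideanSpace ℝ (Fin 3) ≃ₗᵢ[ℝ] EuclideanSpace ℝ (Fin 3)), Finite G ∧
      (∀ g ∈ G, LinearMap.det (g.toLinearEquiv : EuclideanSpace ℝ (Fin 3) →ₗ[ℝ] EuclideanSpace ℝ (Fin 3)) = 1) ∧
      (∀ V : Submodule ℝ (EuclideanSpace ℝ (Fin 3)), (∀ g ∈ G, ∀ v ∈ V, g v ∈ V) → V = ⊥ ∨ V = ⊤) ∧
      ∃ S : ℝ, 0 < S ∧ ∃ (U : ℝ → EuclideanSpace ℝ (Fin 3) → EuclideanSpace ℝ (Fin 3))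
        (P : ℝ → EuclideanSpace ℝ (Fin 3) → ℝ),
        IsBackwardLeraySolutionOn univ 1 U P ∧ Function.Periodic U S ∧
        (∃ C₀ : ℝ, ∀ s y, (1 + ‖y‖) * ‖U s y‖ ≤ C₀) ∧
        (∀ g ∈ G, ∀ s y, U s (g y) = g (U s y)) ∧ (∃ s y, U s y ≠ 0)) :
    _root_.Summit.NavierStokesRegularity.NavierStokesRegularity.Theses.QuantisedSymmetry.PolyhedralDssProfileExists := by
  obtain ⟨G, hfin, hdet, hirr, S, hS, U, P, hsol, hper, ⟨C₀, hC₀⟩, heqv, s₀, y₀, hne⟩ := h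
  -- the physical velocity `u = ofLerayOrbit U` and pressure `ofLerayOrbitPressure P`
  have hcl : IsClassicalNSSolutionOn (Iio 0) 1 0 (ofLerayOrbit U) (ofLerayOrbitPressure P) :=
    isClassicalNSSolutionOn_Iio_ofLerayOrbit_iff.2 hsol
  have hU : lerayOrbit (ofLerayOrbit U) = U := lerayOrbit_ofLerayOrbit_eq U
  have hdecay : HasTypeIDecay C₀ (ofLerayOrbit U) :=
    hasTypeIDecay_iff_lerayOrbit.2 (by rw [hU]; exact hC₀)
  have hanc : IsAncientMildSolution 1 (ofLerayOrbit U) :=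
    Birth.stub_ancientMild_of_classical_typeI (ofLerayOrbit U) (ofLerayOrbitPressure P) C₀ hcl hdecay
  -- the DSS factor `λ = e^{S/2}`, `2 log λ = S`
  have hc_pos : 0 < Real.exp (S / 2) := Real.exp_pos _
  have hc1 : 1 < Real.exp (S / 2) := Real.one_lt_exp_iff.2 (by linarith)
  have hlogc : 2 * Real.log (Real.exp (S / 2)) = S := by rw [Real.log_exp]; ring
  have hdss : IsDiscretelySelfSimilar (Real.exp (S / 2)) (ofLerayOrbit U) := by
    have hper' : Function.Periodic (lerayOrbit (ofLerayOrbit U)) (2 * Real.log (Real.exp (S / 2))) := by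
      rw [hU, hlogc]; exact hper
    have hpast := (periodic_lerayOrbit_iff hc_pos).1 hper'
    funext t x
    by_cases ht : t < 0
    · exact congrFun (hpast t ht) x
    · -- junk region `t ≥ 0`: both sides vanish (`√(−t) = 0`, `0⁻¹ = 0`)
      have ht' : 0 ≤ t := not_lt.1 ht
      have hct : 0 ≤ Real.exp (S / 2) ^ 2 * t := mul_nonneg (sq_nonneg _) ht'
      have h1 : Real.sqrt (-(Real.exp (S / 2) ^ 2 * t)) = 0 := Real.sqrt_eq_zero'.2 (by linarith)
      have h2 : Real.sqrt (-t) = 0 := Real.sqrt_eq_zero'.2 (by linarith)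
      rw [nsRescale_apply, ofLerayOrbit_apply, ofLerayOrbit_apply, h1, h2]
      simp
  -- continuity of the slices on the past
  have hcont : ∀ t < 0, Continuous (ofLerayOrbit U t) := fun t ht =>
    (hcl.contDiff_velocity (S := Iio 0) ht).continuous
  refine ⟨G, hfin, hdet, hirr, Real.exp (S / 2), hc1, ofLerayOrbit U, hanc,
    fun t ht => (hcont t ht).aestronglyMeasurable, hdss, ⟨C₀, hdecay⟩, ?_, ?_⟩
  · -- `G`-equivariance transfers along the linear isometries
    intro g hg t x
    rw [ofLerayOrbit_apply, ofLerayOrbit_apply, ← map_smul g, heqv g hg, map_smul g]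
  · -- nontriviality: a continuous slice that vanishes a.e. vanishes, and `lerayOrbit ∘ ofLerayOrbit = id`
    intro hzero'
    have ht₀ : -Real.exp (-s₀) < 0 := neg_exp_neg_lt_zero s₀
    have hz : ofLerayOrbit U (-Real.exp (-s₀)) = 0 :=
      Measure.eq_of_ae_eq (hzero' _ ht₀) (hcont _ ht₀) continuous_const
    apply hne
    have key := congrFun (congrFun hU s₀) y₀
    rw [lerayOrbit_apply, hz] at key
    simpa using key.symm

/-- **`PolyhedralDssProfileExists ↔ PeriodicLerayOrbitExists`.** The crux of route `QuantisedSymmetry` is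
EQUIVALENT to the existence of a finite irreducible proper rotation group `G`, a period `S > 0` and a nontrivial
`S`-periodic `G`-equivariant classical solution of the backward Leray system on `ℝ × ℝ³` with the profile Type-I
bound `(1 + ‖y‖)‖U(s, y)‖ ≤ C₀` — the object of Bradshaw–Tsai's Open Problem 5.1 / Tsai's Conj. 8.8–8.9 placed
in the polyhedral sector. [cite: BradshawTsai2017CPDE, §5 Open Problem 5.1; ChaeWolf2017RemovingDSS, §4] -/
theorem polyhedralDssProfileExists_iff_periodicLerayOrbit :
    _root_.Summit.NavierStokesRegularity.NavierStokesRegularity.Theses.QuantisedSymmetry.PolyhedralDssProfileExists ↔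
      ∃ G : Subgroup (EuclideanSpace ℝ (Fin 3) ≃ₗᵢ[ℝ] EuclideanSpace ℝ (Fin 3)), Finite G ∧
      (∀ g ∈ G, LinearMap.det (g.toLinearEquiv : EuclideanSpace ℝ (Fin 3) →ₗ[ℝ] EuclideanSpace ℝ (Fin 3)) = 1) ∧
      (∀ V : Submodule ℝ (EuclideanSpace ℝ (Fin 3)), (∀ g ∈ G, ∀ v ∈ V, g v ∈ V) → V = ⊥ ∨ V = ⊤) ∧
      ∃ S : ℝ, 0 < S ∧ ∃ (U : ℝ → EuclideanSpace ℝ (Fin 3) → EuclideanSpace ℝ (Fin 3))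
        (P : ℝ → EuclideanSpace ℝ (Fin 3) → ℝ),
        IsBackwardLeraySolutionOn univ 1 U P ∧ Function.Periodic U S ∧
        (∃ C₀ : ℝ, ∀ s y, (1 + ‖y‖) * ‖U s y‖ ≤ C₀) ∧
        (∀ g ∈ G, ∀ s y, U s (g y) = g (U s y)) ∧ (∃ s y, U s y ≠ 0) :=
  ⟨stub_lerayOrbitOfProfile, polyhedralDssProfileExists_of_periodicLerayOrbit⟩

end Summit.NavierStokesRegularity.NavierStokesRegularity.Theorems.PolyhedralDssProfileExists.PolyhedralCell
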